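import Summits.Ventures.PercRepro.GenQClassTwelveSeventeen

/-!
# PercRepro — the corank-`12` split, part E: five `16`-traces need a `15`-trace (night-4, gen 14)

The `n = 19` twins of part A's lemmas (`s = 16`, the `15`-trace in the role of the `14`-trace; the same proofs, the numbers
shifted by one): two distinct `16`-traces meet `G` in `f ≤ 15` points (`card_inter_le_fifteen_n19`); `f = 15` caps `h₁₆` at
`4` (`card_inter_ne_fifteen_n19`) and `f = 14` produces a `15`-trace (`card_inter_ne_fourteen_n19`).  Hence with `h₁₆ = 5`
and `h₁₅ = 0` the five complements are pairwise disjoint `3`-sets and `L = G ∖ ∪ Cᵢ` has `4` points — but the intersection of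
four of the five traces is a flat of rank `≤ 3` (a rank-`5` flat `H₁ ∩ H₂` is not inside `H₃`, the rank-`≤ 4` flat
`H₁ ∩ H₂ ∩ H₃` is not inside `H₄`) with the `7` points `L ∪ C₅` — more than a flat of rank `≤ 3` of the core holds.  So
**`hypTr_sixteen_le_four_of_fifteen_zero`**: at `n = 19`, `h₁₅ = 0 ⇒ h₁₆ ≤ 4`, and the class `(h₁₆ = 5, h₁₅ = 0)` of the
corank-`12` split (`−19,624` on tree rows) is empty.  Imports `GenQClassTwelveSeventeen` (parts A–D).
-/
namespace PercRepro.Night4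

open Finset ThmH SixFour GenQ PerFlat Star

variable {α : Type*} [DecidableEq α] {M : Matroid α} [M.Finite]

/-- The two `16`-traces are not `G` minus a common point: `|(H₁ ∩ H₂) ∩ G| ≤ 15` for distinct `16`-traces. -/
theorem card_inter_le_fifteen_n19 {G H₁ H₂ : Finset α} (hH₁ : H₁ ∈ flatsTr M G 6 16)
    (hH₂ : H₂ ∈ flatsTr M G 6 16) (hne : H₁ ≠ H₂) : ((H₁ ∩ H₂) ∩ G).card ≤ 15 := by
  have h1 := mem_flatsTr.1 hH₁
  have h2 := mem_flatsTr.1 hH₂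
  by_contra hlt
  rw [not_le] at hlt
  have hsub : (H₁ ∩ H₂) ∩ G ⊆ H₁ ∩ G := by
    intro x hx
    simp only [Finset.mem_inter] at hx ⊢
    exact ⟨hx.1.1, hx.2⟩
  have hsub' : (H₁ ∩ H₂) ∩ G ⊆ H₂ ∩ G := by
    intro x hx
    simp only [Finset.mem_inter] at hx ⊢
    exact ⟨hx.1.2, hx.2⟩
  have hle := Finset.card_le_card hsub
  have heq : (H₁ ∩ H₂) ∩ G = H₁ ∩ G := Finset.eq_of_subset_of_card_le hsub (by omega)
  have heq' : (H₁ ∩ H₂) ∩ G = H₂ ∩ G := Finset.eq_of_subset_of_card_le hsub' (by omega)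
  exact hne (eq_of_inter_eq_of_mem_flatsTr hH₁ hH₂ (heq.symm.trans heq'))


/-- `|(H₁ ∩ H₂) ∩ G| ≠ 15` for distinct `16`-traces when `h₁₆ = 5` (`n = 19`): every `16`-trace would contain the
rank-`5` flat `H₁ ∩ H₂` and be determined by its single point outside it, so `h₁₆ ≤ 4`. -/
theorem card_inter_ne_fifteen_n19 (hs : Simple M) (hline : ∀ L ∈ flatsQ M 2, L.card ≤ 3)
    (hplane : ∀ P ∈ flatsQ M 3, P.card ≤ 6) (hsolid : ∀ F ∈ flatsQ M 4, F.card ≤ 10) {G : Finset α}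
    (hcard : G.card = 19) (h16 : 5 ≤ hypTr M G 6 16) {H₁ H₂ : Finset α} (hH₁ : H₁ ∈ flatsTr M G 6 16)
    (hH₂ : H₂ ∈ flatsTr M G 6 16) (hne : H₁ ≠ H₂) : ((H₁ ∩ H₂) ∩ G).card ≠ 15 := by
  intro h15
  have hB := flats_le_four_card_le_ten hs hline hplane hsolid
  have hF : H₁ ∩ H₂ ∈ flatsQ M 5 :=
    inter_mem_flatsQ_of_large_traces (q := 7) (s := 16) (B := 10) (by norm_num) hB hH₁ hH₂ hne (by omega)
  -- every `16`-trace contains `F = H₁ ∩ H₂`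
  have hall : ∀ H ∈ flatsTr M G 6 16, H₁ ∩ H₂ ⊆ H := by
    intro H hH
    have hH' := mem_flatsTr.1 hH
    refine subset_of_eleven_le_card_inter hB hF (mem_flatsQ.1 hH'.1).2.1 ?_
    have hsub : ((H₁ ∩ H₂) ∩ G) ∩ (H ∩ G) ⊆ (H₁ ∩ H₂) ∩ H := by
      intro x hx
      simp only [Finset.mem_inter] at hx ⊢
      exact ⟨hx.1.1, hx.2.1⟩
    have hU : ((H₁ ∩ H₂) ∩ G) ∪ (H ∩ G) ⊆ G := by
      intro x hx
      simp only [Finset.mem_union, Finset.mem_inter] at hx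
      rcases hx with hx | hx
      · exact hx.2
      · exact hx.2
    have h1 := Finset.card_union_add_card_inter ((H₁ ∩ H₂) ∩ G) (H ∩ G)
    have h2 := Finset.card_le_card hU
    have h3 := Finset.card_le_card hsub
    rw [hH'.2.1, h15] at h1
    omega
  -- the outside set `O = G ∖ F` has `4` points; `H ↦ (H ∩ G) ∖ F` is injective into its `1`-subsets
  have hO : (G \ (H₁ ∩ H₂)).card = 4 := by
    rw [Finset.card_sdiff, hcard, h15]
  have hmaps : Set.MapsTo (fun H : Finset α => (H ∩ G) \ (H₁ ∩ H₂)) (flatsTr M G 6 16 : Set (Finset α))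
      ((G \ (H₁ ∩ H₂)).powersetCard 1 : Set (Finset α)) := by
    intro H hH
    rw [Finset.mem_coe] at hH ⊢
    have hH' := mem_flatsTr.1 hH
    rw [Finset.mem_powersetCard]
    refine ⟨?_, ?_⟩
    · intro x hx
      rw [Finset.mem_sdiff, Finset.mem_inter] at hx
      rw [Finset.mem_sdiff]
      exact ⟨hx.1.2, hx.2⟩
    · have hFsub : (H₁ ∩ H₂) ∩ (H ∩ G) = (H₁ ∩ H₂) ∩ G := by
        ext x
        constructor
        · intro hx
          rw [Finset.mem_inter] at hx ⊢
          exact ⟨hx.1, (Finset.mem_inter.1 hx.2).2⟩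
        · intro hx
          rw [Finset.mem_inter] at hx ⊢
          exact ⟨hx.1, Finset.mem_inter.2 ⟨hall H hH hx.1, hx.2⟩⟩
      rw [Finset.card_sdiff, hFsub, hH'.2.1, h15]
  have hinj : Set.InjOn (fun H : Finset α => (H ∩ G) \ (H₁ ∩ H₂)) (flatsTr M G 6 16 : Set (Finset α)) := by
    intro H hH H' hH' heq
    rw [Finset.mem_coe] at hH hH'
    simp only at heq
    have hdecomp : ∀ K ∈ flatsTr M G 6 16, K ∩ G = ((H₁ ∩ H₂) ∩ G) ∪ ((K ∩ G) \ (H₁ ∩ H₂)) := by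
      intro K hK
      ext x
      rw [Finset.mem_union, Finset.mem_sdiff]
      constructor
      · intro hx
        by_cases hxF : x ∈ H₁ ∩ H₂
        · exact Or.inl (Finset.mem_inter.2 ⟨hxF, (Finset.mem_inter.1 hx).2⟩)
        · exact Or.inr ⟨hx, hxF⟩
      · rintro (hx | hx)
        · rw [Finset.mem_inter] at hx ⊢
          exact ⟨hall K hK hx.1, hx.2⟩
        · exact hx.1
    exact eq_of_inter_eq_of_mem_flatsTr hH hH' (by rw [hdecomp H hH, hdecomp H' hH', heq])
  have hle := Finset.card_le_card_of_injOn _ hmaps hinj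
  rw [Finset.card_powersetCard, hO] at hle
  unfold hypTr at h16
  have : Nat.choose 4 1 = 4 := by decide
  omega

/-- `|(H₁ ∩ H₂) ∩ G| ≠ 14` for distinct `16`-traces when `h₁₅ = 0` (`n = 19`): the point `y` of `G` outside both
traces spans with `F = H₁ ∩ H₂` a hyperplane whose trace is exactly `(F ∩ G) ∪ {y}`, a `16`-trace. -/
theorem card_inter_ne_fourteen_n19 (hs : Simple M) (hline : ∀ L ∈ flatsQ M 2, L.card ≤ 3)
    (hplane : ∀ P ∈ flatsQ M 3, P.card ≤ 6) (hsolid : ∀ F ∈ flatsQ M 4, F.card ≤ 10) {G : Finset α}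
    (hG : G ⊆ gr M) (hcard : G.card = 19) (h15 : hypTr M G 6 15 = 0) {H₁ H₂ : Finset α}
    (hH₁ : H₁ ∈ flatsTr M G 6 16) (hH₂ : H₂ ∈ flatsTr M G 6 16) (hne : H₁ ≠ H₂) :
    ((H₁ ∩ H₂) ∩ G).card ≠ 14 := by
  intro h14
  have hB := flats_le_four_card_le_ten hs hline hplane hsolid
  have hF : H₁ ∩ H₂ ∈ flatsQ M 5 :=
    inter_mem_flatsQ_of_large_traces (q := 7) (s := 16) (B := 10) (by norm_num) hB hH₁ hH₂ hne (by omega)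
  have hF' := mem_flatsQ.1 hF
  have h1 := mem_flatsTr.1 hH₁
  have h2 := mem_flatsTr.1 hH₂
  -- the point `y` outside both traces
  have hU : (H₁ ∩ G) ∪ (H₂ ∩ G) ⊆ G := by
    intro x hx
    simp only [Finset.mem_union, Finset.mem_inter] at hx
    rcases hx with hx | hx
    · exact hx.2
    · exact hx.2
  have hUcard : ((H₁ ∩ G) ∪ (H₂ ∩ G)).card = 18 := by
    have := Finset.card_union_add_card_inter (H₁ ∩ G) (H₂ ∩ G)
    rw [← inter_inter_eq, h14, h1.2.1, h2.2.1] at this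
    omega
  obtain ⟨y, hyG, hyU⟩ := Finset.exists_mem_notMem_of_card_lt_card (by rw [hUcard, hcard]; norm_num : ((H₁ ∩ G) ∪ (H₂ ∩ G)).card < G.card)
  have hyH₁ : y ∉ H₁ := fun h => hyU (Finset.mem_union.2 (Or.inl (Finset.mem_inter.2 ⟨h, hyG⟩)))
  have hyH₂ : y ∉ H₂ := fun h => hyU (Finset.mem_union.2 (Or.inr (Finset.mem_inter.2 ⟨h, hyG⟩)))
  have hyF : y ∉ H₁ ∩ H₂ := fun h => hyH₁ (Finset.mem_inter.1 h).1
  -- `F ∩ G` spans `F`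
  have hrFG : M.eRk (((H₁ ∩ H₂) ∩ G : Finset α) : Set α) = ((7 - 2 : ℕ) : ℕ∞) :=
    eRk_eq_of_subset_flat_of_flats_le (q := 7) (B := 10) (by norm_num) hB hG hF (Finset.Subset.refl _) (by omega)
  have hclFG : M.closure (((H₁ ∩ H₂) ∩ G : Finset α) : Set α) = ((H₁ ∩ H₂ : Finset α) : Set α) := by
    have := (M.isRkFinite_of_finite (Finset.finite_toSet ((H₁ ∩ H₂) ∩ G))).closure_eq_closure_of_subset_of_eRk_ge_eRk
      (Finset.coe_subset.2 (Finset.inter_subset_left : (H₁ ∩ H₂) ∩ G ⊆ H₁ ∩ H₂)) (by rw [hrFG, hF'.2.2])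
    rw [this, hF'.2.1.closure]
  -- `X = (F ∩ G) ∪ {y}` has rank `6`
  set X : Finset α := insert y ((H₁ ∩ H₂) ∩ G) with hXdef
  have hXG : X ⊆ G := by
    intro x hx
    rw [hXdef, Finset.mem_insert] at hx
    rcases hx with hx | hx
    · rw [hx]; exact hyG
    · exact (Finset.mem_inter.1 hx).2
  have hyE : y ∈ M.E := by
    rw [← coe_gr M]
    exact Finset.mem_coe.2 (hG hyG)
  have hrX : M.eRk (X : Set α) = ((6 : ℕ) : ℕ∞) := by
    rw [hXdef, Finset.coe_insert, Matroid.eRk_insert_eq_add_one, hrFG]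
    · norm_num
    · rw [Set.mem_sdiff, hclFG]
      exact ⟨hyE, fun h => hyF (Finset.mem_coe.1 h)⟩
  have hXcard : X.card = 15 := by
    rw [hXdef, Finset.card_insert_of_notMem, h14]
    intro h
    exact hyF (Finset.mem_inter.1 h).1
  -- the hyperplane `K = cl X` has trace exactly `X`
  have hK := clF_mem_flatsTr hG hXG hrX
  have hXK : X ⊆ clF M X ∩ G := by
    intro x hx
    refine Finset.mem_inter.2 ⟨?_, hXG hx⟩
    rw [← Finset.mem_coe, coe_clF]
    exact M.subset_closure _ (by rw [← coe_gr M]; exact Finset.coe_subset.2 (hXG.trans hG)) (Finset.mem_coe.2 hx)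
  have hFK : H₁ ∩ H₂ ⊆ clF M X := by
    intro x hx
    rw [← Finset.mem_coe, coe_clF]
    have hsub : M.closure (((H₁ ∩ H₂) ∩ G : Finset α) : Set α) ⊆ M.closure (X : Set α) :=
      M.closure_subset_closure (Finset.coe_subset.2 (by rw [hXdef]; exact Finset.subset_insert _ _))
    exact hsub (by rw [hclFG]; exact Finset.mem_coe.2 hx)
  have hKX : clF M X ∩ G ⊆ X := by
    intro z hz
    rw [Finset.mem_inter] at hz
    by_cases hzF : z ∈ H₁ ∩ H₂
    · rw [hXdef]; exact Finset.mem_insert_of_mem (Finset.mem_inter.2 ⟨hzF, hz.2⟩)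
    -- `z ∉ F`: `z = y` or `z` lies in one of the two traces and drags it into `K`
    have hzE : z ∈ M.E := by
      rw [← coe_gr M]
      exact Finset.mem_coe.2 (hG hz.2)
    have hpull : ∀ H ∈ flatsTr M G 6 16, H₁ ∩ H₂ ⊆ H → z ∈ H → H = clF M X := by
      intro H hH hFH hzH
      have hH' := mem_flatsTr.1 hH
      have hrz : M.eRk ((insert z (H₁ ∩ H₂) : Finset α) : Set α) = ((6 : ℕ) : ℕ∞) := by
        rw [Finset.coe_insert, Matroid.eRk_insert_eq_add_one, hF'.2.2]
        · norm_num
        · rw [Set.mem_sdiff, hF'.2.1.closure]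
          exact ⟨hzE, fun h => hzF (Finset.mem_coe.1 h)⟩
      have hsub : H ⊆ clF M X :=
        subset_of_subset_of_eRk_eq hH'.1 (mem_flatsQ.1 (mem_flatsTr.1 hK).1).2.1
          (Finset.insert_subset hzH hFH) (Finset.insert_subset hz.1 hFK) hrz
      exact eq_of_subset_of_mem_flatsQ hH'.1 (mem_flatsTr.1 hK).1 hsub
    by_cases hzH₁ : z ∈ H₁
    · exfalso
      have := hpull H₁ hH₁ Finset.inter_subset_left hzH₁
      exact hyH₁ (by rw [this]; exact (Finset.mem_inter.1 (hXK (Finset.mem_insert_self _ _))).1)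
    by_cases hzH₂ : z ∈ H₂
    · exfalso
      have := hpull H₂ hH₂ Finset.inter_subset_right hzH₂
      exact hyH₂ (by rw [this]; exact (Finset.mem_inter.1 (hXK (Finset.mem_insert_self _ _))).1)
    -- `z ∉ H₁ ∪ H₂`, so `z = y` (the union has `17` points)
    have hzy : z = y := by
      by_contra hzy
      have hsub : insert z ((H₁ ∩ G) ∪ (H₂ ∩ G)) ⊆ G := by
        intro x hx
        rw [Finset.mem_insert] at hx
        rcases hx with hx | hx
        · rw [hx]; exact hz.2
        · exact hU hx
      have hcard' : (insert z ((H₁ ∩ G) ∪ (H₂ ∩ G))).card = 19 := by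
        rw [Finset.card_insert_of_notMem, hUcard]
        intro h
        rw [Finset.mem_union, Finset.mem_inter, Finset.mem_inter] at h
        rcases h with h | h
        · exact hzH₁ h.1
        · exact hzH₂ h.1
      have heq : insert z ((H₁ ∩ G) ∪ (H₂ ∩ G)) = G := Finset.eq_of_subset_of_card_le hsub (by omega)
      have hy' : y ∈ insert z ((H₁ ∩ G) ∪ (H₂ ∩ G)) := by rw [heq]; exact hyG
      rw [Finset.mem_insert] at hy'
      rcases hy' with hy' | hy'
      · exact hzy hy'.symm
      · exact hyU hy'
    rw [hzy, hXdef]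
    exact Finset.mem_insert_self _ _
  have hKG : clF M X ∩ G = X := Finset.Subset.antisymm hKX hXK
  rw [hKG, hXcard] at hK
  unfold hypTr at h15
  rw [Finset.card_eq_zero] at h15
  rw [h15] at hK
  exact Finset.notMem_empty _ hK


/-- Distinct `16`-traces meet `G` in exactly `13` points when `h₁₆ ≥ 5` and `h₁₅ = 0` (`n = 19`). -/
theorem card_inter_eq_thirteen_n19 (hs : Simple M) (hline : ∀ L ∈ flatsQ M 2, L.card ≤ 3)
    (hplane : ∀ P ∈ flatsQ M 3, P.card ≤ 6) (hsolid : ∀ F ∈ flatsQ M 4, F.card ≤ 10) {G : Finset α}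
    (hG : G ⊆ gr M) (hcard : G.card = 19) (h16 : 5 ≤ hypTr M G 6 16) (h15 : hypTr M G 6 15 = 0)
    {H₁ H₂ : Finset α} (hH₁ : H₁ ∈ flatsTr M G 6 16) (hH₂ : H₂ ∈ flatsTr M G 6 16) (hne : H₁ ≠ H₂) :
    ((H₁ ∩ H₂) ∩ G).card = 13 := by
  have h13 := two_mul_sub_le_card_inter_of_mem_flatsTr hH₁ hH₂
  have h15' := card_inter_le_fifteen_n19 hH₁ hH₂ hne
  have hn14 := card_inter_ne_fourteen_n19 hs hline hplane hsolid hG hcard h15 hH₁ hH₂ hne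
  have hn15 := card_inter_ne_fifteen_n19 hs hline hplane hsolid hcard h16 hH₁ hH₂ hne
  omega

/-- Every point of `G` lies in one of two distinct `16`-traces (`h₁₆ ≥ 5`, `h₁₅ = 0`, `n = 19`). -/
theorem mem_or_mem_of_ne_n19 (hs : Simple M) (hline : ∀ L ∈ flatsQ M 2, L.card ≤ 3)
    (hplane : ∀ P ∈ flatsQ M 3, P.card ≤ 6) (hsolid : ∀ F ∈ flatsQ M 4, F.card ≤ 10) {G : Finset α}
    (hG : G ⊆ gr M) (hcard : G.card = 19) (h16 : 5 ≤ hypTr M G 6 16) (h15 : hypTr M G 6 15 = 0)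
    {H₁ H₂ : Finset α} (hH₁ : H₁ ∈ flatsTr M G 6 16) (hH₂ : H₂ ∈ flatsTr M G 6 16) (hne : H₁ ≠ H₂)
    {x : α} (hx : x ∈ G) : x ∈ H₁ ∨ x ∈ H₂ := by
  have h13 := card_inter_eq_thirteen_n19 hs hline hplane hsolid hG hcard h16 h15 hH₁ hH₂ hne
  have h1 := mem_flatsTr.1 hH₁
  have h2 := mem_flatsTr.1 hH₂
  have hU : (H₁ ∩ G) ∪ (H₂ ∩ G) ⊆ G := by
    intro z hz
    simp only [Finset.mem_union, Finset.mem_inter] at hz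
    rcases hz with hz | hz
    · exact hz.2
    · exact hz.2
  have hUcard : ((H₁ ∩ G) ∪ (H₂ ∩ G)).card = 19 := by
    have := Finset.card_union_add_card_inter (H₁ ∩ G) (H₂ ∩ G)
    rw [← inter_inter_eq, h13, h1.2.1, h2.2.1] at this
    omega
  have heq : (H₁ ∩ G) ∪ (H₂ ∩ G) = G := Finset.eq_of_subset_of_card_le hU (by omega)
  have hx' : x ∈ (H₁ ∩ G) ∪ (H₂ ∩ G) := by rw [heq]; exact hx
  simp only [Finset.mem_union, Finset.mem_inter] at hx'
  rcases hx' with hx' | hx'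
  · exact Or.inl hx'.1
  · exact Or.inr hx'.1

/-- **At `n = 19`, `h₁₅ = 0` forces `h₁₆ ≤ 4`**: five `16`-traces with pairwise disjoint `3`-point complements would make
the intersection of four of them a flat of rank `≤ 3` with `19 − 12 = 7` points of `G`. -/
theorem hypTr_sixteen_le_four_of_fifteen_zero (hs : Simple M) (hline : ∀ L ∈ flatsQ M 2, L.card ≤ 3)
    (hplane : ∀ P ∈ flatsQ M 3, P.card ≤ 6) (hsolid : ∀ F ∈ flatsQ M 4, F.card ≤ 10) {G : Finset α}
    (hG : G ⊆ gr M) (hcard : G.card = 19) (h15 : hypTr M G 6 15 = 0) : hypTr M G 6 16 ≤ 4 := by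
  by_contra hlt
  rw [not_le] at hlt
  have h16 : 5 ≤ hypTr M G 6 16 := by omega
  have hB := flats_le_four_card_le_ten hs hline hplane hsolid
  have hB3 := flats_le_three_card_le_six hs hline hplane
  have hmem := fun {H₁ H₂ : Finset α} (hH₁ : H₁ ∈ flatsTr M G 6 16) (hH₂ : H₂ ∈ flatsTr M G 6 16) (hne : H₁ ≠ H₂)
    {x : α} (hx : x ∈ G) => mem_or_mem_of_ne_n19 hs hline hplane hsolid hG hcard h16 h15 hH₁ hH₂ hne hx
  -- four distinct `16`-traces
  obtain ⟨H₁, H₂, H₃, hH₁, hH₂, hH₃, h12, h13, h23⟩ :=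
    Finset.two_lt_card_iff.1 (by unfold hypTr at h16; omega : 2 < (flatsTr M G 6 16).card)
  obtain ⟨H₄, hH₄'⟩ : ((flatsTr M G 6 16) \ {H₁, H₂, H₃}).Nonempty := by
    rw [← Finset.card_pos]
    have hle := Finset.card_le_card (Finset.inter_subset_right : (flatsTr M G 6 16) ∩ {H₁, H₂, H₃} ⊆ {H₁, H₂, H₃})
    have h3 : ({H₁, H₂, H₃} : Finset (Finset α)).card ≤ 3 := Finset.card_le_three
    have := Finset.card_sdiff_add_card_inter (flatsTr M G 6 16) {H₁, H₂, H₃}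
    unfold hypTr at h16
    omega
  rw [Finset.mem_sdiff, Finset.mem_insert, Finset.mem_insert, Finset.mem_singleton] at hH₄'
  obtain ⟨hH₄, hH₄ne⟩ := hH₄'
  have h14 : H₁ ≠ H₄ := fun h => hH₄ne (Or.inl h.symm)
  have h24 : H₂ ≠ H₄ := fun h => hH₄ne (Or.inr (Or.inl h.symm))
  have h34 : H₃ ≠ H₄ := fun h => hH₄ne (Or.inr (Or.inr h.symm))
  -- a point of `G` outside `Hₖ` lies in every other trace
  have hout : ∀ {H H' : Finset α}, H ∈ flatsTr M G 6 16 → H' ∈ flatsTr M G 6 16 → H ≠ H' →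
      ∀ {c : α}, c ∈ G → c ∉ H' → c ∈ H := by
    intro H H' hH hH' hne c hc hcH'
    rcases hmem hH hH' hne hc with h | h
    · exact h
    · exact absurd h hcH'
  have hGH : ∀ {H : Finset α}, H ∈ flatsTr M G 6 16 → (G \ H).card = 3 := by
    intro H hH
    rw [Finset.card_sdiff, hcard, (mem_flatsTr.1 hH).2.1]
  -- `F = H₁ ∩ H₂` (rank `5`), `S = F ∩ H₃` (rank `≤ 4`), `P = S ∩ H₄` (rank `≤ 3`)
  have hF : H₁ ∩ H₂ ∈ flatsQ M 5 :=
    inter_mem_flatsQ_of_large_traces (q := 7) (s := 16) (B := 10) (by norm_num) hB hH₁ hH₂ h12 (by omega)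
  have hnot3 : ¬ H₁ ∩ H₂ ⊆ H₃ := by
    intro hsub
    obtain ⟨c, hc⟩ : (G \ H₃).Nonempty := by rw [← Finset.card_pos, hGH hH₃]; norm_num
    rw [Finset.mem_sdiff] at hc
    exact hc.2 (hsub (Finset.mem_inter.2 ⟨hout hH₁ hH₃ h13 hc.1 hc.2, hout hH₂ hH₃ h23 hc.1 hc.2⟩))
  obtain ⟨b, hS, hb⟩ := exists_inter_mem_flatsQ_lt_of_not_subset hF (mem_flatsQ.1 (mem_flatsTr.1 hH₃).1).2.1 hnot3
  have hnot4 : ¬ (H₁ ∩ H₂) ∩ H₃ ⊆ H₄ := by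
    intro hsub
    obtain ⟨c, hc⟩ : (G \ H₄).Nonempty := by rw [← Finset.card_pos, hGH hH₄]; norm_num
    rw [Finset.mem_sdiff] at hc
    exact hc.2 (hsub (Finset.mem_inter.2 ⟨Finset.mem_inter.2 ⟨hout hH₁ hH₄ h14 hc.1 hc.2, hout hH₂ hH₄ h24 hc.1 hc.2⟩,
      hout hH₃ hH₄ h34 hc.1 hc.2⟩))
  obtain ⟨b', hP, hb'⟩ := exists_inter_mem_flatsQ_lt_of_not_subset hS (mem_flatsQ.1 (mem_flatsTr.1 hH₄).1).2.1 hnot4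
  have hsix : (((H₁ ∩ H₂) ∩ H₃) ∩ H₄).card ≤ 6 := hB3 b' (by omega) _ hP
  -- `P` has `≥ 19 − 12 = 7` points of `G`
  have hcover : G \ (((H₁ ∩ H₂) ∩ H₃) ∩ H₄) ⊆ (G \ H₁) ∪ ((G \ H₂) ∪ ((G \ H₃) ∪ (G \ H₄))) := by
    intro x hx
    simp only [Finset.mem_sdiff, Finset.mem_inter, Finset.mem_union] at hx ⊢
    by_cases h1 : x ∈ H₁
    · by_cases h2 : x ∈ H₂
      · by_cases h3 : x ∈ H₃
        · exact Or.inr (Or.inr (Or.inr ⟨hx.1, fun h4 => hx.2 ⟨⟨⟨h1, h2⟩, h3⟩, h4⟩⟩))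
        · exact Or.inr (Or.inr (Or.inl ⟨hx.1, h3⟩))
      · exact Or.inr (Or.inl ⟨hx.1, h2⟩)
    · exact Or.inl ⟨hx.1, h1⟩
  have hle := (Finset.card_le_card hcover).trans ((Finset.card_union_le _ _).trans (Nat.add_le_add_left
    ((Finset.card_union_le _ _).trans (Nat.add_le_add_left (Finset.card_union_le _ _) _)) _))
  rw [hGH hH₁, hGH hH₂, hGH hH₃, hGH hH₄] at hle
  have hsd := Finset.card_sdiff (s := ((H₁ ∩ H₂) ∩ H₃) ∩ H₄) (t := G)
  have hsub := Finset.card_le_card (Finset.inter_subset_left : (((H₁ ∩ H₂) ∩ H₃) ∩ H₄) ∩ G ⊆ ((H₁ ∩ H₂) ∩ H₃) ∩ H₄)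
  omega

end PercRepro.Night4
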